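import Literature.Combinatorics.Additive.BalogSzemerediGowersMultiplicative
import Literature.Combinatorics.Additive.SumProductFp

/-!
# Popular differences of a set with small product set — the two counting engines

Topic `Literature/Combinatorics/Additive`. Everything here is PROVED; no definitions, no named facts.

For a zero-free finite `A ⊂ 𝔽` and `d ≠ 0` write `r = r_{A−A}(d) = #{(a, a') ∈ A² : a − a' = d}`
and `X = A·A`.

* `card_mul_repr_sq_le_addEnergy_mul` — **a popular difference of `A` gives `|A|` popular
  differences of `AA`**: the differences `x d` (`x ∈ A`) of `X` each have `≥ r` representations,
  so `E₊(X) ≥ |A| · r²`; rendered as an injection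
  `(x, (a,a'), (b,b')) ↦ ((xa, xb), (xb', xa'))` into the energy quadruples of `X`.
* `card_mul_mul_mul_card_pow_le` — **Plünnecke–Ruzsa in `𝔽ˣ`**: `|(AA)(AA)| · |A|⁴ ≤ |AA|⁴ · |A|`
  (transfer to `Additive 𝔽ˣ` via `Literature…BalogSzemerediGowersMultiplicative`, then Mathlib's
  additive Plünnecke–Ruzsa cleared of denominators, `card_nsmul_mul_pow_le`).
* small bookkeeping facts: `r ≤ |A|`, `0 ∉ AA`, `|A| ≤ |AA|`.

These feed `PopularDifferencesSmallProductSet.lean` (the bound `r ≤ C K^c |A|^{1−κ₀}` for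
`|AA| ≤ K|A|`, `|A|² ≤ 2p`), which removes the Stevens–de Zeeuw incidence bound from sector A of the
crux `DlogGraphFlat` (`Summits/QuantumAdvantage`). [folklore arguments; cf. Bourgain–Glibichuk–Konyagin
2006 and Garaev 2007 for the milieu]
-/

namespace Literature.Combinatorics.Additive

open Finset
open scoped Pointwise Combinatorics.Additive

section PDEnergy

variable {F : Type*} [Field F] [DecidableEq F]

/-- `r_{A−A}(d) ≤ |A|`: the first coordinate determines the pair. [folklore] -/
theorem card_filter_sub_eq_le_card (A : Finset F) (d : F) :
    ((A ×ˢ A).filter fun x : F × F => x.1 - x.2 = d).card ≤ A.card := by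
  refine Finset.card_le_card_of_injOn (fun x => x.1) ?_ ?_
  · intro x hx
    rw [Finset.mem_coe, Finset.mem_filter, Finset.mem_product] at hx
    exact hx.1.1
  · intro x hx x' hx' h
    rw [Finset.mem_coe, Finset.mem_filter] at hx hx'
    simp only at h
    refine Prod.ext h ?_
    have e1 := hx.2
    have e2 := hx'.2
    rw [h] at e1
    linear_combination e2 - e1

/-- A product set of a zero-free set is zero-free. [folklore] -/
theorem zero_not_mem_mul (A B : Finset F) (hA : (0 : F) ∉ A) (hB : (0 : F) ∉ B) :
    (0 : F) ∉ A * B := by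
  intro h
  rw [Finset.mem_mul] at h
  obtain ⟨a, ha, b, hb, hab⟩ := h
  rcases mul_eq_zero.mp hab with h0 | h0
  · exact hA (h0 ▸ ha)
  · exact hB (h0 ▸ hb)

/-- `|A| ≤ |A·A|` for non-empty zero-free `A` (a dilate `aA` lies in `AA`). [folklore] -/
theorem card_le_card_mul_self_of_zero_not_mem (A : Finset F) (hA : (0 : F) ∉ A) (hne : A.Nonempty) :
    A.card ≤ (A * A).card := by
  obtain ⟨a, ha⟩ := hne
  have ha0 : a ≠ 0 := fun h => hA (h ▸ ha)
  calc A.card = (a • A).card := (Finset.card_smul_finset₀ ha0 A).symm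
    _ ≤ (A * A).card := Finset.card_le_card (Finset.smul_finset_subset_mul ha)

/-- **A popular difference of `A` makes `|A|` popular differences of `AA`**: for zero-free `A` and
`d ≠ 0`, `|A| · r_{A−A}(d)² ≤ E₊(AA)`, via the injection
`(x, (a,a'), (b,b')) ↦ ((xa, xb), (xb', xa'))` into `{(x₁,x₂,y₁,y₂) ∈ (AA)⁴ : x₁ + y₁ = x₂ + y₂}`.
[folklore] -/
theorem card_mul_repr_sq_le_addEnergy_mul (A : Finset F) (hA : (0 : F) ∉ A) {d : F} (hd : d ≠ 0) :
    A.card * (((A ×ˢ A).filter fun x : F × F => x.1 - x.2 = d).card *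
      ((A ×ˢ A).filter fun x : F × F => x.1 - x.2 = d).card) ≤
      Finset.addEnergy (A * A) (A * A) := by
  classical
  set Rep := (A ×ˢ A).filter fun x : F × F => x.1 - x.2 = d with hRep
  unfold Finset.addEnergy
  rw [← Finset.card_product, ← Finset.card_product]
  refine Finset.card_le_card_of_injOn
    (fun t : F × ((F × F) × (F × F)) =>
      ((t.1 * t.2.1.1, t.1 * t.2.2.1), (t.1 * t.2.2.2, t.1 * t.2.1.2))) ?_ ?_
  · intro t ht
    rw [Finset.mem_coe, Finset.mem_product, Finset.mem_product, hRep, Finset.mem_filter,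
      Finset.mem_filter, Finset.mem_product, Finset.mem_product] at ht
    obtain ⟨hx, ⟨⟨ha, ha'⟩, hda⟩, ⟨⟨hb, hb'⟩, hdb⟩⟩ := ht
    rw [Finset.mem_coe, Finset.mem_filter, Finset.mem_product, Finset.mem_product,
      Finset.mem_product]
    refine ⟨⟨⟨Finset.mul_mem_mul hx ha, Finset.mul_mem_mul hx hb⟩,
      Finset.mul_mem_mul hx hb', Finset.mul_mem_mul hx ha'⟩, ?_⟩
    simp only
    linear_combination t.1 * (hda - hdb)
  · intro t ht t' ht' h
    rw [Finset.mem_coe, Finset.mem_product, Finset.mem_product, hRep, Finset.mem_filter,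
      Finset.mem_filter] at ht ht'
    simp only [Prod.mk.injEq] at h
    obtain ⟨⟨h1, h2⟩, h3, h4⟩ := h
    obtain ⟨hx, ⟨_, hda⟩, ⟨_, hdb⟩⟩ := ht
    obtain ⟨hx', ⟨_, hda'⟩, ⟨_, hdb'⟩⟩ := ht'
    have hx0 : t.1 ≠ 0 := fun e => hA (e ▸ hx)
    -- t.1 * d = t'.1 * d  ⇒  t.1 = t'.1
    have hxx : t.1 = t'.1 := by
      have e : t.1 * d = t'.1 * d := by
        have e1 : t.1 * d = t.1 * t.2.1.1 - t.1 * t.2.1.2 := by rw [← hda]; ring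
        have e2 : t'.1 * d = t'.1 * t'.2.1.1 - t'.1 * t'.2.1.2 := by rw [← hda']; ring
        rw [e1, e2, h1, h4]
      exact mul_right_cancel₀ hd e
    rw [← hxx] at h2 h3 h4 h1
    have e1 : t.2.1.1 = t'.2.1.1 := mul_left_cancel₀ hx0 h1
    have e2 : t.2.2.1 = t'.2.2.1 := mul_left_cancel₀ hx0 h2
    have e3 : t.2.2.2 = t'.2.2.2 := mul_left_cancel₀ hx0 h3
    have e4 : t.2.1.2 = t'.2.1.2 := mul_left_cancel₀ hx0 h4
    exact Prod.ext hxx (Prod.ext (Prod.ext e1 e4) (Prod.ext e2 e3))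

/-- **Plünnecke–Ruzsa in `𝔽ˣ` for the double product set**: for zero-free non-empty `A`,
`|(AA)(AA)| · |A|⁴ ≤ |AA|⁴ · |A|` (so `|AA| ≤ K|A|` gives `|(AA)(AA)| ≤ K⁴|A|`). Transfer to
`Additive 𝔽ˣ` and Mathlib's additive Plünnecke–Ruzsa. [folklore] -/
theorem card_mul_mul_mul_card_pow_le (A : Finset F) (hA0 : (0 : F) ∉ A) (hne : A.Nonempty) :
    ((A * A) * (A * A)).card * A.card ^ 4 ≤ (A * A).card ^ 4 * A.card := by
  classical
  set φ : Additive Fˣ → F := fun x => ((Additive.toMul x : Fˣ) : F) with hφ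
  have hinj : Function.Injective φ := val_toMul_injective
  set Au := A.preimage φ hinj.injOn with hAu
  have himg : Au.image φ = A := image_val_preimage_units A hA0
  have hcard : Au.card = A.card := by rw [← himg, Finset.card_image_of_injective _ hinj]
  have hAune : Au.Nonempty := by
    rw [← Finset.card_pos, hcard, Finset.card_pos]; exact hne
  have h2 : (Au + Au).image φ = A * A := by rw [image_val_add_eq_mul, himg]
  have h4 : ((Au + Au) + (Au + Au)).image φ = (A * A) * (A * A) := by
    rw [image_val_add_eq_mul, h2]
  have hc2 : (Au + Au).card = (A * A).card := by rw [← h2, Finset.card_image_of_injective _ hinj]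
  have hc4 : ((Au + Au) + (Au + Au)).card = ((A * A) * (A * A)).card := by
    rw [← h4, Finset.card_image_of_injective _ hinj]
  have hPR := card_nsmul_mul_pow_le hAune Au 4
  have e4 : (4 : ℕ) • Au = (Au + Au) + (Au + Au) := by
    rw [show (4 : ℕ) = 0 + 1 + 1 + 1 + 1 from rfl]
    simp only [succ_nsmul, zero_nsmul, zero_add]
    rw [add_assoc]
  rw [e4, hc4, hc2, hcard] at hPR
  exact hPR

end PDEnergy

end Literature.Combinatorics.Additive
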